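import Summits.QuantumFields.YangMills.Theorems.BalabanUVNodesN21ThresholdSyncAtRecord
import Summits.QuantumFields.YangMills.Theorems.BalabanUVNodesN21SlotTestAtRecord

/-!
# YM-DAG node N21 (= NE7c) AT THE RECORD — CUBE-PARTITION SYNCHRONISATION: WHEN the two runs' (2.17) cube families OF RECORD coincide.
# `Node00.RkOfRecord L r g = L^{s(g)}` ([Balaban1988Convergent] (2.5) p. 255: the least power of `L` above `(log g⁻²)^r`) is an antitone STEP FUNCTION of the
# coupling; the sync hypothesis `hR` of `BalabanUVNodesN21SlotTestAtRecord.abs_chiOfRecord_sub_chiOfRecord_le_sum_slotBands` (p452009) holds exactly when the two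
# couplings' `(log g⁻²)^r` lie in the same `L`-adic window, and — in node U2's currency — FAILS ONLY when `(log g⁻²)^r` sits within
# `r·(log g⁻²)^{r−1}·g′²·|1∕g² − 1∕g′²|` above a power of `L` (the quantitative form of located finding (L2))

Track A of `YM-PLAN.md` (cell `pub-ymgap`, HUMAN RULING D-0062), node **N21**; R134 fan-out seat `pub-ymgap-dag-n21-d` (s2), fourth module (companion of
p452009 and p455507).  Kernel bookkeeping BY NAME over def-R's `Node00.RkOfRecord` ∕ `Node00.exists_pow_ge_of_two_le` (`Node00/SmallFieldChiOfRecord.lean`) and this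
seat's coupling algebra (`N21ThresholdSyncAtRecord.log_invSq_sub_le`, `…powSucc_sub_powSucc_le_mul_sub`); 0 `def`, 0 `sorry`, standard axioms; COUNT-NEUTRAL;
`--supports` the K3 item `SpineGivenEndpointR11` (stmt-QuantumFields-19676).

WHAT IS PROVED ([folklore] arithmetic of a step function; nothing of Bałaban's asserted).
* §1 `RkOfRecord_eq_pow_find` (for `L ≥ 2`, `R(g) = L^{Nat.find}` of the least admissible exponent) · `RkOfRecord_congr` (two couplings whose `(log g⁻²)^r` pass the
  SAME powers of `L` have the same `R`) · `RkOfRecord_antitone` (`0 < g ≤ g′ ≤ 1 ⇒ R(g′) ≤ R(g)`: a larger coupling has a smaller logarithm, hence a smaller cube).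
* §2 THE WINDOW CRITERION: if `(log g′⁻²)^r ≤ (log g⁻²)^r ≤ L^s` and every smaller power `L^{s′}`, `s′ < s`, is `< (log g′⁻²)^r`, then `R(g) = R(g′) = L^s`
  (`RkOfRecord_eq_of_window`) — sync holds throughout each `L`-adic window of `(log g⁻²)^r`.
* §3 IN U2's CURRENCY: `(log g⁻²)^r − (log g′⁻²)^r ≤ r·(log g⁻²)^{r−1}·g′²·(1∕g² − 1∕g′²)` for `0 < g ≤ g′ ≤ 1` (`powr_log_sub_le`), so the MARGIN form
  `RkOfRecord_eq_of_margin`: if `(log g⁻²)^r ≤ L^s` and `L^{s′} + r·(log g⁻²)^{r−1}·g′²(1∕g² − 1∕g′²) < (log g⁻²)^r` for all `s′ < s`, then `R(g) = R(g′)` — the two runs'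
  (2.17) partitions of record DIFFER ONLY at levels where `(log g_A⁻²)^r` lies within the U2-controlled margin above a power of `L` (with `U2Output`: margin
  `≤ r(log g⁻²)^{r−1}·γ²·Cout·θ^j`, geometric in the level).
* §4 Back to p452009: `abs_chiOfRecord_sub_le_sum_slotBands_of_window` — the slot-band cover with `hR` DISCHARGED on a common window.

HONEST FRAMING.  Where the window criterion fails (finitely many `L`-adic boundaries per run, since `R` is antitone along a run with decreasing coupling) the two-run
mismatch of the record's small-field functions is NOT a threshold shell but a background-LOCALITY width of the (2.16) local minimisers on nested cube families
([Balaban1988Convergent] (2.16), [Balaban1989LargeFieldI] (1.74) species — N12 ∕ N07's object, not typed here); nothing of Bałaban's is asserted; NE7c NOT proved;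
typed 28∕28, discharged count untouched; one finite four-torus programme at fixed `ε` — NOT ℝ⁴, NOT infinite volume, NOT OS, NOT a mass gap, NOT Clay.  Restate-immune.
No decl below carries a cite tag.
-/

noncomputable section

namespace Summit.QuantumFields.YangMills.Theorems.N21CubeSyncAtRecord

open Literature.MathematicalPhysics.QuantumFieldTheory.Balaban1983to89
open Literature.MathematicalPhysics.QuantumFieldTheory.Balaban1983to89.Node00 (RkOfRecord exists_pow_ge_of_two_le)
open Summit.QuantumFields.YangMills.Theorems.N21ThresholdSyncAtRecord (log_invSq_sub_le powSucc_sub_powSucc_le_mul_sub)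

/-! ## §1 `R(g)` as the least power of `L` above `(log g⁻²)^r`; congruence; antitonicity in the coupling -/

/-- For `L ≥ 2`, `R(g) = L^{s}` with `s` the LEAST exponent such that `(log g⁻²)^r ≤ L^s` (the `dif_pos` branch of def-R's total definition). [bookkeeping] -/
theorem RkOfRecord_eq_pow_find {L : ℕ} (hL : 2 ≤ L) (r : ℕ) (g : ℝ) :
    RkOfRecord L r g = L ^ Nat.find (exists_pow_ge_of_two_le hL r g) := by
  unfold RkOfRecord
  rw [dif_pos (exists_pow_ge_of_two_le hL r g)]

/-- **CONGRUENCE**: two couplings whose `(log g⁻²)^r` lie below exactly the same powers of `L` have the same `R`. [bookkeeping] -/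
theorem RkOfRecord_congr {L : ℕ} (hL : 2 ≤ L) (r : ℕ) {g g' : ℝ}
    (hiff : ∀ s : ℕ, (Real.log (g ^ 2)⁻¹) ^ r ≤ ((L ^ s : ℕ) : ℝ) ↔ (Real.log (g' ^ 2)⁻¹) ^ r ≤ ((L ^ s : ℕ) : ℝ)) :
    RkOfRecord L r g = RkOfRecord L r g' := by
  rw [RkOfRecord_eq_pow_find hL r g, RkOfRecord_eq_pow_find hL r g']
  congr 1
  exact Nat.find_congr' fun {s} => hiff s

/-- **ANTITONICITY IN THE COUPLING**: for `0 < g ≤ g′ ≤ 1` the larger coupling has the smaller logarithm, so every power of `L` admissible for `g` is admissible for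
`g′` and `R(g′) ≤ R(g)` — along a run with DECREASING couplings (asymptotic freedom, towards the ultraviolet) the cubes of record GROW. [bookkeeping] -/
theorem RkOfRecord_antitone {L : ℕ} (hL : 2 ≤ L) (r : ℕ) {g g' : ℝ} (hg : 0 < g) (hgg' : g ≤ g') (hg'1 : g' ≤ 1) :
    RkOfRecord L r g' ≤ RkOfRecord L r g := by
  have hg' : 0 < g' := lt_of_lt_of_le hg hgg'
  have hone : 1 ≤ (g' ^ 2)⁻¹ := one_le_inv_iff₀.mpr ⟨by positivity, by nlinarith⟩
  have hlog0 : 0 ≤ Real.log (g' ^ 2)⁻¹ := Real.log_nonneg hone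
  have hlog : Real.log (g' ^ 2)⁻¹ ≤ Real.log (g ^ 2)⁻¹ :=
    Real.log_le_log (by positivity) (inv_anti₀ (by positivity) (by nlinarith))
  have hpow : (Real.log (g' ^ 2)⁻¹) ^ r ≤ (Real.log (g ^ 2)⁻¹) ^ r := pow_le_pow_left₀ hlog0 hlog r
  rw [RkOfRecord_eq_pow_find hL r g, RkOfRecord_eq_pow_find hL r g']
  apply Nat.pow_le_pow_right (by omega)
  exact Nat.find_mono fun s hs => hpow.trans hs

/-! ## §2 The window criterion: sync holds throughout each `L`-adic window of `(log g⁻²)^r` -/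

/-- **THE WINDOW CRITERION.**  If `(log g′⁻²)^r ≤ (log g⁻²)^r ≤ L^s` and every smaller power is passed by both (`L^{s′} < (log g′⁻²)^r` for `s′ < s`), then
`R(g) = L^s = R(g′)`: both least exponents are `s` (`Nat.find_eq_iff`). [bookkeeping] -/
theorem RkOfRecord_eq_of_window {L : ℕ} (hL : 2 ≤ L) (r : ℕ) {g g' : ℝ} {s : ℕ}
    (hx'x : (Real.log (g' ^ 2)⁻¹) ^ r ≤ (Real.log (g ^ 2)⁻¹) ^ r) (hs : (Real.log (g ^ 2)⁻¹) ^ r ≤ ((L ^ s : ℕ) : ℝ))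
    (hlo : ∀ s' : ℕ, s' < s → ((L ^ s' : ℕ) : ℝ) < (Real.log (g' ^ 2)⁻¹) ^ r) :
    RkOfRecord L r g = L ^ s ∧ RkOfRecord L r g' = L ^ s := by
  have hfind : Nat.find (exists_pow_ge_of_two_le hL r g) = s :=
    (Nat.find_eq_iff _).mpr ⟨hs, fun n hn h => absurd (hx'x.trans h) (not_le.mpr (hlo n hn))⟩
  have hfind' : Nat.find (exists_pow_ge_of_two_le hL r g') = s :=
    (Nat.find_eq_iff _).mpr ⟨hx'x.trans hs, fun n hn h => absurd h (not_le.mpr (hlo n hn))⟩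
  rw [RkOfRecord_eq_pow_find hL r g, RkOfRecord_eq_pow_find hL r g', hfind, hfind']
  exact ⟨rfl, rfl⟩

/-- Corollary: under the window criterion the two runs' (2.17) cube families of record COINCIDE — the sync hypothesis `hR` of p452009's
`abs_chiOfRecord_sub_chiOfRecord_le_sum_slotBands`. [bookkeeping] -/
theorem RkOfRecord_eq_RkOfRecord_of_window {L : ℕ} (hL : 2 ≤ L) (r : ℕ) {g g' : ℝ} {s : ℕ}
    (hx'x : (Real.log (g' ^ 2)⁻¹) ^ r ≤ (Real.log (g ^ 2)⁻¹) ^ r) (hs : (Real.log (g ^ 2)⁻¹) ^ r ≤ ((L ^ s : ℕ) : ℝ))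
    (hlo : ∀ s' : ℕ, s' < s → ((L ^ s' : ℕ) : ℝ) < (Real.log (g' ^ 2)⁻¹) ^ r) :
    RkOfRecord L r g = RkOfRecord L r g' := by
  obtain ⟨h1, h2⟩ := RkOfRecord_eq_of_window hL r hx'x hs hlo
  rw [h1, h2]

/-! ## §3 In node U2's currency: the margin above a power of `L` within which sync can fail -/

/-- **`(log g⁻²)^r − (log g′⁻²)^r ≤ r·(log g⁻²)^{r−1}·g′²·(1∕g² − 1∕g′²)`** for `0 < g ≤ g′ ≤ 1` (mean-value bound for the `r`-th power on the ordered logarithms,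
then `log g⁻² − log g′⁻² ≤ g′²(1∕g² − 1∕g′²)` of p455507).  Stated at `r = q + 1`; at `r = 0` both sides vanish. [bookkeeping] -/
theorem powr_log_sub_le {g g' : ℝ} (hg : 0 < g) (hgg' : g ≤ g') (hg'1 : g' ≤ 1) (q : ℕ) :
    (Real.log (g ^ 2)⁻¹) ^ (q + 1) - (Real.log (g' ^ 2)⁻¹) ^ (q + 1) ≤
      ((q : ℝ) + 1) * (Real.log (g ^ 2)⁻¹) ^ q * (g' ^ 2 * (1 / g ^ 2 - 1 / g' ^ 2)) := by
  have hg' : 0 < g' := lt_of_lt_of_le hg hgg'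
  have hb : 0 ≤ Real.log (g' ^ 2)⁻¹ := Real.log_nonneg (one_le_inv_iff₀.mpr ⟨by positivity, by nlinarith⟩)
  have hba : Real.log (g' ^ 2)⁻¹ ≤ Real.log (g ^ 2)⁻¹ :=
    Real.log_le_log (by positivity) (inv_anti₀ (by positivity) (by nlinarith))
  have ha : 0 ≤ Real.log (g ^ 2)⁻¹ := hb.trans hba
  have h1 := powSucc_sub_powSucc_le_mul_sub hb hba q
  have h2 := log_invSq_sub_le hg hgg'
  have hc : 0 ≤ ((q : ℝ) + 1) * (Real.log (g ^ 2)⁻¹) ^ q := by positivity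
  exact h1.trans (mul_le_mul_of_nonneg_left h2 hc)

/-- **THE MARGIN CRITERION (quantitative (L2)).**  Let `0 < g ≤ g′ ≤ 1`, `r = q + 1`, and `s` with `(log g⁻²)^r ≤ L^s`.  If for every `s′ < s` the power `L^{s′}` lies
below `(log g⁻²)^r` by MORE than the margin `r·(log g⁻²)^{r−1}·g′²(1∕g² − 1∕g′²)`, then `R(g) = R(g′)`.  With node U2's `disc = |1∕g² − 1∕g′²| ≤ Cout·θ^j` and the window
`g, g′ ≤ γ` the margin is `≤ r(log g⁻²)^{r−1}·γ²·Cout·θ^j`: the two runs' (2.17) partitions of record differ ONLY at levels where `(log g_A⁻²)^r` sits within that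
(geometrically shrinking) distance above a power of `L`. [bookkeeping] -/
theorem RkOfRecord_eq_of_margin {L : ℕ} (hL : 2 ≤ L) (q : ℕ) {g g' : ℝ} (hg : 0 < g) (hgg' : g ≤ g') (hg'1 : g' ≤ 1) {s : ℕ}
    (hs : (Real.log (g ^ 2)⁻¹) ^ (q + 1) ≤ ((L ^ s : ℕ) : ℝ))
    (hmargin : ∀ s' : ℕ, s' < s →
      ((L ^ s' : ℕ) : ℝ) + ((q : ℝ) + 1) * (Real.log (g ^ 2)⁻¹) ^ q * (g' ^ 2 * (1 / g ^ 2 - 1 / g' ^ 2)) < (Real.log (g ^ 2)⁻¹) ^ (q + 1)) :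
    RkOfRecord L (q + 1) g = RkOfRecord L (q + 1) g' := by
  have hg' : 0 < g' := lt_of_lt_of_le hg hgg'
  have hb : 0 ≤ Real.log (g' ^ 2)⁻¹ := Real.log_nonneg (one_le_inv_iff₀.mpr ⟨by positivity, by nlinarith⟩)
  have hba : Real.log (g' ^ 2)⁻¹ ≤ Real.log (g ^ 2)⁻¹ :=
    Real.log_le_log (by positivity) (inv_anti₀ (by positivity) (by nlinarith))
  have hx'x : (Real.log (g' ^ 2)⁻¹) ^ (q + 1) ≤ (Real.log (g ^ 2)⁻¹) ^ (q + 1) := pow_le_pow_left₀ hb hba _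
  have hsub := powr_log_sub_le hg hgg' hg'1 q
  refine RkOfRecord_eq_RkOfRecord_of_window hL (q + 1) hx'x hs fun s' hs' => ?_
  have hm := hmargin s' hs'
  linarith

/-! ## §4 Back to the slot test of record: the slot-band cover with the sync hypothesis DISCHARGED on a common window -/

section BackToChi

open Node00
open Summit.QuantumFields.YangMills.Theorems.N21SlotTestAtRecord (abs_chiOfRecord_sub_chiOfRecord_le_sum_slotBands)
open Literature.MathematicalPhysics.QuantumFieldTheory.Balaban1983to89.GaugeField (plaqHol)
open Literature.MathematicalPhysics.QuantumFieldTheory.Balaban1983to89.B14.Eq216Concrete (ukBox)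
open Finset

variable (F : T4Continuum.T4Family) (N : ℕ) [NeZero N]

/-- **p452009's COVER WITH `hR` DISCHARGED.**  Two coupling sequences `g, g′` whose level-`k` couplings are ordered (`0 < g_k ≤ g′_k ≤ 1`) and whose
`(log ·⁻²)^r` share an `L`-adic window at level `k` (§2's criterion, `L = F.L ≥ 2` by `T4Family.hL`): then the two runs' (2.17) cube families of record coincide
and the two-run mismatch of `Node00.chiOfRecord` is covered by the single-run slot bands of p452009 (threshold band + variable band per cube), under the displayed
per-cube closeness of the (2.16) local backgrounds. [bookkeeping] -/
theorem abs_chiOfRecord_sub_le_sum_slotBands_of_window (ν : Stage7Numerics) (g g' : ℕ → ℝ) (K k : ℕ) {s : ℕ}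
    (hx'x : (Real.log ((g' k) ^ 2)⁻¹) ^ ν.r ≤ (Real.log ((g k) ^ 2)⁻¹) ^ ν.r)
    (hs : (Real.log ((g k) ^ 2)⁻¹) ^ ν.r ≤ (((F.P K).L ^ s : ℕ) : ℝ))
    (hlo : ∀ s' : ℕ, s' < s → (((F.P K).L ^ s' : ℕ) : ℝ) < (Real.log ((g' k) ^ 2)⁻¹) ^ ν.r)
    (V V' : GaugeField (F.P K) k (SU N)) {Δ : ℝ}
    (hΔ : ∀ a ∈ cubeIndices (F.P K) (cubeSide (F.P K).L ν.M₂ (RkOfRecord (F.P K).L ν.r (g k)) k),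
      ∀ p ∈ plaqInside (cubeEnl (F.P K) (cubeSide (F.P K).L ν.M₂ (RkOfRecord (F.P K).L ν.r (g k)) k) a 1),
        |dist1 (plaqHol (ukBox (bgOfRecord (avOfRecord F N K) {U | PlaqSmall (ν.εreg * (F.P K).eta k ^ 2) U}) ν.M₁
              (cubeEnl (F.P K) (cubeSide (F.P K).L ν.M₂ (RkOfRecord (F.P K).L ν.r (g k)) k) a 4) k V) p) -
          dist1 (plaqHol (ukBox (bgOfRecord (avOfRecord F N K) {U | PlaqSmall (ν.εreg * (F.P K).eta k ^ 2) U}) ν.M₁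
              (cubeEnl (F.P K) (cubeSide (F.P K).L ν.M₂ (RkOfRecord (F.P K).L ν.r (g k)) k) a 4) k V') p)| ≤ Δ)
    {B : ℝ}
    (hB : ∑ a ∈ cubeIndices (F.P K) (cubeSide (F.P K).L ν.M₂ (RkOfRecord (F.P K).L ν.r (g k)) k),
        ((chiSmall (plaqInside (cubeEnl (F.P K) (cubeSide (F.P K).L ν.M₂ (RkOfRecord (F.P K).L ν.r (g k)) k) a 1))
              (max (epsOfRecord ν g k * (F.P K).eta k ^ 2) (epsOfRecord ν g' k * (F.P K).eta k ^ 2))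
              (ukBox (bgOfRecord (avOfRecord F N K) {U | PlaqSmall (ν.εreg * (F.P K).eta k ^ 2) U}) ν.M₁
                (cubeEnl (F.P K) (cubeSide (F.P K).L ν.M₂ (RkOfRecord (F.P K).L ν.r (g k)) k) a 4) k V) -
            chiSmall (plaqInside (cubeEnl (F.P K) (cubeSide (F.P K).L ν.M₂ (RkOfRecord (F.P K).L ν.r (g k)) k) a 1))
              (min (epsOfRecord ν g k * (F.P K).eta k ^ 2) (epsOfRecord ν g' k * (F.P K).eta k ^ 2))
              (ukBox (bgOfRecord (avOfRecord F N K) {U | PlaqSmall (ν.εreg * (F.P K).eta k ^ 2) U}) ν.M₁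
                (cubeEnl (F.P K) (cubeSide (F.P K).L ν.M₂ (RkOfRecord (F.P K).L ν.r (g k)) k) a 4) k V)) +
          (chiSmall (plaqInside (cubeEnl (F.P K) (cubeSide (F.P K).L ν.M₂ (RkOfRecord (F.P K).L ν.r (g k)) k) a 1))
              (epsOfRecord ν g' k * (F.P K).eta k ^ 2 + Δ)
              (ukBox (bgOfRecord (avOfRecord F N K) {U | PlaqSmall (ν.εreg * (F.P K).eta k ^ 2) U}) ν.M₁
                (cubeEnl (F.P K) (cubeSide (F.P K).L ν.M₂ (RkOfRecord (F.P K).L ν.r (g k)) k) a 4) k V) -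
            chiSmall (plaqInside (cubeEnl (F.P K) (cubeSide (F.P K).L ν.M₂ (RkOfRecord (F.P K).L ν.r (g k)) k) a 1))
              (epsOfRecord ν g' k * (F.P K).eta k ^ 2 - Δ)
              (ukBox (bgOfRecord (avOfRecord F N K) {U | PlaqSmall (ν.εreg * (F.P K).eta k ^ 2) U}) ν.M₁
                (cubeEnl (F.P K) (cubeSide (F.P K).L ν.M₂ (RkOfRecord (F.P K).L ν.r (g k)) k) a 4) k V))) ≤ B) :
    |chiOfRecord F N ν g K k V - chiOfRecord F N ν g' K k V'| ≤ B := by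
  have hL : 2 ≤ (F.P K).L := by rw [T4Continuum.T4Family.P_L]; exact F.hL.2
  have hR : RkOfRecord (F.P K).L ν.r (g k) = RkOfRecord (F.P K).L ν.r (g' k) :=
    RkOfRecord_eq_RkOfRecord_of_window hL ν.r hx'x hs hlo
  exact (abs_chiOfRecord_sub_chiOfRecord_le_sum_slotBands F N ν g g' K k hR V V' hΔ).trans hB

end BackToChi

end Summit.QuantumFields.YangMills.Theorems.N21CubeSyncAtRecord

end
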